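import Mathlib
import Literature.NumberTheory.LFunctions.Zhang2022.Section11SjTrueSizeBound
import Literature.NumberTheory.LFunctions.Zhang2022.Section11WindowMeanSquareJ2
import Literature.NumberTheory.LFunctions.Zhang2022.Section11WindowCoefficientsSharp
import HarnessLib

/-!
# Zhang (2022) §11 p. 64: the two window mean squares `Z22:§11.u019` and its `J₂`-twin HOLD —
# `Step11u019 c′` and `Step11u019J2 c′` for every sufficiently large `c′`

Topic `Literature/NumberTheory/LFunctions/Zhang2022` (Landau–Siegel audit tree; verdict-neutral).
Y. Zhang, *Discrete mean estimates and the Landau–Siegel zero*, arXiv:2211.02515v1 (2022)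
[Zhang2022LandauSiegel], §11 p. 64, tex L3298–L3301: "By (11.3), (8.25) and (8.26),
`Σ_{ψ∈Ψ₁}Σ_{ρ∈Z̃(ψ)} 𝔠*(ρ,ψ)|Σ_{n∈𝔍₁}χψ(n)n^{−ρ}(f̃(log n/log P) − g̃₁(n))|²ω(ρ) = o(𝔞𝔓)`" and
tex L3306 "Similarly" (the `J₂`-side twin) — **an unrefereed manuscript under adjudication;
nothing here asserts or denies its Theorems 1–2.** The displays "(8.25), (8.26)" do not exist in
v1 (§8 ends at (8.24); cell GAP row G-L3t10-1). ZHANG-L discharge lane, WP11: this file CLOSES the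
two leaves `h19 = Typed.TypedSection11B.Step11u019 c′` and `h19J2 = Step11u019J2 c′` of
`Skeleton.theorem1_of_leaves_v19` (rank 29/30), BY NAME, in the accepted shape
`∃ c₀, ∀ c′ ≥ c₀, …`.

Route (every input a tree theorem; no new definition, no fact, no window structure, no
short-interval input):

* the MEAN-VALUE half (zl-libB-p3, `Section11WindowMeanSquare(J2)`):
  `step11u019_of_sjWindow_eventually` / `step11u019J2_of_sjWindow_eventually` — Lemma 2.3,
  Prop. 2.2 (i), Lemma 8.1, Prop. 7.1, `𝔞 ≫ 1` (all tree theorems for large `c′`) reduce each leaf to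
  "`𝓛⁹·|S_j(𝐚,𝐚̄)| → 0` (`j = 1,2,3`)" for the window sequence `𝐚`;
* the SHARP (11.3) (zl-libB-p1, `Section11WindowCoefficientsSharp`, from the tree's proof of
  Lemma 11.1): `|a(n)| ≤ 1000·𝓛⁻²⁴` termwise (`norm_window_le_sharp`, `norm_window₂_le_sharp`);
* the TRUE-SIZE `S_j`-engine (zl-w11-p2, `Section11SjTrueSizeBound`, from the exact local factors
  of `ξ₀ⱼ` in `AppendixALemma83Local` / `AppendixAXiZeroMult`): `|S_j(𝐚₁,𝐚₂)| ≤ C_S·B₁B₂·𝓛²⁷`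
  for `|a_i| ≤ B_i` (`norm_Sj_le_of_bounds`).

Hence `𝓛⁹|S_j(𝐚,𝐚̄)| ≤ 10⁶C_S·𝓛⁻¹² ≤ ε` for `𝓛 ≥ 10⁶C_S/ε` (`sj_window_small`,
`sj_window₂_small`), and the leaves follow (`step11u019_holds`, `step11u019J2_holds`).
What this is: kernel theorems about the TYPED-AS-PRINTED displays of an unrefereed manuscript;
the §18 margin is refuted as printed (G-C1); no claim about Landau–Siegel zeros or Theorem 2
follows.

## References

* Y. Zhang, arXiv:2211.02515v1 (2022), §11 p. 64 (tex L3295–L3307), Lemma 11.1 (11.3) p. 63,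
  §7 Prop. 7.1 p. 33, §8 Lemma 8.1. [cite: Zhang2022LandauSiegel, §11 p.64]
-/

noncomputable section

open Finset Real Complex ComplexConjugate

namespace Literature.NumberTheory.LFunctions.Zhang2022.Typed.TypedSection11B

open Literature.NumberTheory.LFunctions.Zhang2022.Skeleton
open Literature.NumberTheory.LFunctions.Zhang2022.XiZeroMajorant
open Literature.NumberTheory.LFunctions.Zhang2022.Section11WindowMeanSquare

/-! ### The closing budget: `𝓛⁹·C_S·B²·𝓛²⁷ = 10⁶C_S𝓛⁻¹²` for `B = 1000𝓛⁻²⁴` -/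

/-- The absolute constant `C_S` of `norm_Sj_le_of_bounds` is positive. [folklore] -/
private theorem sjConst_pos :
    0 < 4 * Real.exp (4 + LogEulerProduct.tailConst 0) *
      Real.exp (16 + 7 * LogEulerProduct.tailConst 0) *
      Real.exp (28 + 14 * LogEulerProduct.tailConst 0) *
      (3 * Real.exp (4 + 1134 * π + (12 + 56 * LogEulerProduct.tailConst 3) +
        7 * (2 + LogEulerProduct.tailConst 3) * LogEulerProduct.tailConst 4)) := by
  positivity

/-- The budget: for `ℓ ≥ 1`, `0 < C` and `10⁶C/ε ≤ ℓ`,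
`ℓ⁹·(C·(1000ℓ⁻²⁴)·(1000ℓ⁻²⁴)·ℓ²⁷) ≤ ε`. [folklore] -/
private theorem budget_le {ℓ C ε : ℝ} (hℓ : 1 ≤ ℓ) (hC : 0 < C) (hε : 0 < ε)
    (hbig : 10 ^ 6 * C / ε ≤ ℓ) :
    ℓ ^ 9 * (C * (1000 * (ℓ ^ 24)⁻¹) * (1000 * (ℓ ^ 24)⁻¹) * ℓ ^ 27) ≤ ε := by
  have hℓ0 : 0 < ℓ := by linarith
  have hℓne : ℓ ≠ 0 := hℓ0.ne'
  have e : ℓ ^ 9 * (C * (1000 * (ℓ ^ 24)⁻¹) * (1000 * (ℓ ^ 24)⁻¹) * ℓ ^ 27) =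
      10 ^ 6 * C / ℓ ^ 12 := by
    field_simp
    ring
  rw [e]
  have h12 : ℓ ≤ ℓ ^ 12 := by
    calc ℓ = ℓ ^ 1 := (pow_one ℓ).symm
      _ ≤ ℓ ^ 12 := pow_le_pow_right₀ hℓ (by norm_num)
  calc 10 ^ 6 * C / ℓ ^ 12 ≤ 10 ^ 6 * C / ℓ :=
        div_le_div_of_nonneg_left (by positivity) hℓ0 h12
    _ ≤ ε := by
        rw [div_le_iff₀ hℓ0]
        have := (div_le_iff₀ hε).mp hbig
        linarith

/-- From `⌈exp K⌉ ≤ D`: `K ≤ log D = 𝓛`. [folklore] -/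
private theorem le_ell_of_ceil_exp_le {K : ℝ} {D : ℕ} (hD : ⌈Real.exp K⌉₊ ≤ D) : K ≤ ell D := by
  have hexp : Real.exp K ≤ D := le_trans (Nat.le_ceil _) (by exact_mod_cast hD)
  rw [ell]
  exact (Real.le_log_iff_exp_le (lt_of_lt_of_le (Real.exp_pos _) hexp)).mpr hexp

/-- **The generic closing step**: if a `D`-indexed family of sequences `a_D` satisfies
`|a_D(n)| ≤ 1000·𝓛⁻²⁴` termwise for all large `D`, then `𝓛⁹·|S_j(𝐚,𝐚̄)| → 0` for `j = 1, 2, 3`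
(in the `∀ ε > 0, ForAllLarge …` form consumed by `step11u019_of_sjWindow`), by
`norm_Sj_le_of_bounds` with `B₁ = B₂ = 1000𝓛⁻²⁴`. [cite: Zhang2022LandauSiegel, §11 p.64] -/
theorem sj_small_of_norm_le (c' : ℝ) (a : (D : ℕ) → DirichletCharacter ℂ D → ℕ → ℂ)
    (ha : ForAllLarge fun D _ χ => ∀ n : ℕ, ‖a D χ n‖ ≤ 1000 * (ell D ^ 24)⁻¹) :
    ∀ ε : ℝ, 0 < ε → ForAllLarge fun D _ χ => AssumptionA D χ →
      ∀ j ∈ ({1, 2, 3} : Finset ℕ),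
        ell D ^ 9 * ‖Sj c' D j (a D χ) (fun n : ℕ => conj (a D χ n))‖ ≤ ε := by
  intro ε hε
  obtain ⟨D₁, h₁⟩ := ha
  set C : ℝ := 4 * Real.exp (4 + LogEulerProduct.tailConst 0) *
      Real.exp (16 + 7 * LogEulerProduct.tailConst 0) *
      Real.exp (28 + 14 * LogEulerProduct.tailConst 0) *
      (3 * Real.exp (4 + 1134 * π + (12 + 56 * LogEulerProduct.tailConst 3) +
        7 * (2 + LogEulerProduct.tailConst 3) * LogEulerProduct.tailConst 4)) with hC
  have hC0 : 0 < C := sjConst_pos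
  refine ⟨max D₁ (max ⌈Real.exp (5 * |c'| * π + 3)⌉₊ ⌈Real.exp (10 ^ 6 * C / ε + 3)⌉₊),
    fun D _ χ hD hq hp _ j _ => ?_⟩
  have hD₁ : D₁ ≤ D := le_trans (le_max_left _ _) hD
  have hD₂ : ⌈Real.exp (5 * |c'| * π + 3)⌉₊ ≤ D :=
    le_trans (le_trans (le_max_left _ _) (le_max_right _ _)) hD
  have hD₃ : ⌈Real.exp (10 ^ 6 * C / ε + 3)⌉₊ ≤ D :=
    le_trans (le_trans (le_max_right _ _) (le_max_right _ _)) hD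
  obtain ⟨hL3, -⟩ := three_le_ell_and_Bsum_le hD₂
  have hbig : 10 ^ 6 * C / ε ≤ ell D := by
    have := le_ell_of_ceil_exp_le hD₃; linarith
  have hB : ∀ n : ℕ, ‖a D χ n‖ ≤ 1000 * (ell D ^ 24)⁻¹ := h₁ D χ hD₁ hq hp
  have hB' : ∀ n : ℕ, ‖conj (a D χ n)‖ ≤ 1000 * (ell D ^ 24)⁻¹ := fun n => by
    rw [Complex.norm_conj]; exact hB n
  have hS := norm_Sj_le_of_bounds hD₂ j hB hB'
  rw [← hC] at hS
  calc ell D ^ 9 * ‖Sj c' D j (a D χ) (fun n : ℕ => conj (a D χ n))‖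
      ≤ ell D ^ 9 * (C * (1000 * (ell D ^ 24)⁻¹) * (1000 * (ell D ^ 24)⁻¹) * ell D ^ 27) :=
        mul_le_mul_of_nonneg_left hS (by positivity)
    _ ≤ ε := budget_le (by linarith) hC0 hε hbig

/-! ### `Z22:§11.u019`: the `𝔍₁`-window mean square -/

/-- **`𝓛⁹·|S_j(𝐚,𝐚̄)| → 0`** for the `𝔍₁`-window sequence
`𝐚 = χ·1_{𝔍₁}·(f̃(log ·/log P) − g̃₁)` (`|a| ≤ 1000𝓛⁻²⁴` by the sharp (11.3)).
[cite: Zhang2022LandauSiegel, §11 p.64, tex L3298–L3301] -/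
theorem sj_window_small (c' : ℝ) :
    ∀ ε : ℝ, 0 < ε → ForAllLarge fun D _ χ => AssumptionA D χ →
      ∀ j ∈ ({1, 2, 3} : Finset ℕ), ell D ^ 9 * ‖Sj c' D j
        (fun n : ℕ => if n ∈ frakI1Nat D then χ (n : ZMod D) *
          (((ftilde (Real.log n / Real.log (bigP D)) : ℝ) : ℂ) - ((gtilde1 D n : ℝ) : ℂ)) else 0)
        (fun n : ℕ => conj (if n ∈ frakI1Nat D then χ (n : ZMod D) *
          (((ftilde (Real.log n / Real.log (bigP D)) : ℝ) : ℂ) - ((gtilde1 D n : ℝ) : ℂ)) else 0))‖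
        ≤ ε :=
  sj_small_of_norm_le c' (fun D χ n => if n ∈ frakI1Nat D then χ (n : ZMod D) *
      (((ftilde (Real.log n / Real.log (bigP D)) : ℝ) : ℂ) - ((gtilde1 D n : ℝ) : ℂ)) else 0)
    norm_window_le_sharp

/-- **`Z22:§11.u019` HOLDS for every sufficiently large `c′`** — the leaf `h19` of
`Skeleton.theorem1_of_leaves_v19`, BY NAME: "By (11.3), [(8.25) and (8.26)],
`ΣΣ𝔠*(ρ,ψ)|Σ_{n∈𝔍₁}χψ(n)n^{−ρ}(f̃(log n/log P) − g̃₁(n))|²ω(ρ) = o(𝔞𝔓)`" (p. 64): from the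
mean-value half (`step11u019_of_sjWindow_eventually`: Lemma 2.3, Prop. 2.2 (i), Lemma 8.1,
Prop. 7.1, `𝔞 ≫ 1`, all tree theorems for large `c′`) and `sj_window_small`.
[cite: Zhang2022LandauSiegel, §11 p.64, tex L3298–L3301] -/
theorem step11u019_holds : ∃ c₀ : ℝ, ∀ c' ≥ c₀, Step11u019 c' := by
  obtain ⟨c₀, -, h⟩ := step11u019_of_sjWindow_eventually
  exact ⟨c₀, fun c' hc' => h c' hc' (sj_window_small c')⟩

/-- `Z22:§11.u019` in the `0 ≤ c₀ ∧ …` packaging of `Section11WindowMeanSquare`.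
[cite: Zhang2022LandauSiegel, §11 p.64, tex L3298–L3301] -/
theorem step11u019_holds' : ∃ c₀ : ℝ, 0 ≤ c₀ ∧ ∀ c' : ℝ, c₀ ≤ c' → Step11u019 c' := by
  obtain ⟨c₀, h0, h⟩ := step11u019_of_sjWindow_eventually
  exact ⟨c₀, h0, fun c' hc' => h c' hc' (sj_window_small c')⟩

/-! ### The `J₂`-twin behind "Similarly" (`Z22:§11.u021`) -/

/-- **`𝓛⁹·|S_j(𝐚,𝐚̄)| → 0`** for the `𝔍₂`-window sequence
`𝐚 = χ·1_{𝔍₂}·(f̃(log ·/log P + 0.004 − α̃) − g̃₂)` (`|a| ≤ 1000𝓛⁻²⁴`, `norm_window₂_le_sharp`).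
[cite: Zhang2022LandauSiegel, §11 p.64, tex L3306] -/
theorem sj_window₂_small (c' : ℝ) :
    ∀ ε : ℝ, 0 < ε → ForAllLarge fun D _ χ => AssumptionA D χ →
      ∀ j ∈ ({1, 2, 3} : Finset ℕ), ell D ^ 9 * ‖Sj c' D j
        (fun n : ℕ => if n ∈ frakI2Nat D then χ (n : ZMod D) *
          (((ftilde (Real.log n / Real.log (bigP D) + 0.004 - alphaTilde D) : ℝ) : ℂ) -
            ((gtilde2 D n : ℝ) : ℂ)) else 0)
        (fun n : ℕ => conj (if n ∈ frakI2Nat D then χ (n : ZMod D) *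
          (((ftilde (Real.log n / Real.log (bigP D) + 0.004 - alphaTilde D) : ℝ) : ℂ) -
            ((gtilde2 D n : ℝ) : ℂ)) else 0))‖ ≤ ε :=
  sj_small_of_norm_le c' (fun D χ n => if n ∈ frakI2Nat D then χ (n : ZMod D) *
      (((ftilde (Real.log n / Real.log (bigP D) + 0.004 - alphaTilde D) : ℝ) : ℂ) -
        ((gtilde2 D n : ℝ) : ℂ)) else 0)
    norm_window₂_le_sharp

/-- **`Step11u019J2 c′` HOLDS for every sufficiently large `c′`** — the leaf `h19J2` of
`Skeleton.theorem1_of_leaves_v19`, BY NAME (the unprinted `J₂`-side window mean square behind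
"Similarly", p. 64 tex L3306): from `step11u019J2_of_sjWindow_eventually` and `sj_window₂_small`.
[cite: Zhang2022LandauSiegel, §11 p.64, tex L3306] -/
theorem step11u019J2_holds : ∃ c₀ : ℝ, ∀ c' ≥ c₀, Step11u019J2 c' := by
  obtain ⟨c₀, -, h⟩ := step11u019J2_of_sjWindow_eventually
  exact ⟨c₀, fun c' hc' => h c' hc' (sj_window₂_small c')⟩

/-- `Step11u019J2` in the `0 ≤ c₀ ∧ …` packaging. [cite: Zhang2022LandauSiegel, §11 p.64, tex L3306] -/
theorem step11u019J2_holds' : ∃ c₀ : ℝ, 0 ≤ c₀ ∧ ∀ c' : ℝ, c₀ ≤ c' → Step11u019J2 c' := by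
  obtain ⟨c₀, h0, h⟩ := step11u019J2_of_sjWindow_eventually
  exact ⟨c₀, h0, fun c' hc' => h c' hc' (sj_window₂_small c')⟩

/-- **Both §11 window mean squares for every sufficiently large `c′`, jointly** (one threshold;
the form the skeleton pen plugs into `theorem1_of_leaves_v19`'s binders `h19`, `h19J2`).
[cite: Zhang2022LandauSiegel, §11 p.64] -/
theorem step11u019_and_J2_holds :
    ∃ c₀ : ℝ, ∀ c' ≥ c₀, Step11u019 c' ∧ Step11u019J2 c' := by
  obtain ⟨c₁, h₁⟩ := step11u019_holds
  obtain ⟨c₂, h₂⟩ := step11u019J2_holds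
  exact ⟨max c₁ c₂, fun c' hc' =>
    ⟨h₁ c' (le_trans (le_max_left _ _) hc'), h₂ c' (le_trans (le_max_right _ _) hc')⟩⟩

end Literature.NumberTheory.LFunctions.Zhang2022.Typed.TypedSection11B

end
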